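import Literature.AnabelianGeometry.SemiGraphs.TemperedSpecialFibreTowerPiData
import Literature.AnabelianGeometry.SemiGraphs.TemperedEdgeInVerticialProofs
import HarnessLib

/-!
# The special fibre's cusp ↦ OPEN-EDGE dictionary — ORIGIN DATUM (P3′) `SpecialFibreTower.PiData.CuspOpenEdgeDict`
# ([SemiAnbd] Ex. 3.10 p. 44, §6 p. 71; [IUTchI] Cor. 2.3 (vi) p. 48) — successor of `PiData`, policy D

Mochizuki, *Semi-graphs of anabelioids*, Publ. RIMS **42** (2006), §3, Example 3.10, manuscript p. 44 ("`G^c` … the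
semi-graph of anabelioids … [with compact structure] associated to the geometric special fiber of the stable model of
`X^log_K`": vertices = irreducible components, closed edges = nodes, OPEN edges = the cusps [marked points] of `X_K`)
[cite: MochizukiSemiAnbd2006, Ex 3.10 p.44], §6 p. 71 ("`I_x := D_x ∩ Δ^temp_X` is isomorphic to `Ẑ(1)` … if `x` is … a
cusp"); S. Mochizuki, *Inter-universal Teichmüller theory I*, §2, Cor. 2.3 (vi) p. 48 ("`x` is a cusp … `ξ` the cusp of
the stable model corresponding to `x` … `ξ` meets an irreducible component of the special fiber")
[cite: Mochizuki2012, Cor 2.3(vi) p.48] [claim: Mochizuki2012, status: disputed].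

abc-iut cell, seat abc-iut-L5-d5 gen 8; GAP-LEDGER row **G-w4d070-g11-1** (and its refinement, the binder `hdict`/`hdictO`
of abc-iut-w4-d059's `TemperedCoveringsCor23viHat(Cusp)IncidenceReduction.lean`); successor style of abc-iut-w4-d052's
`TemperedSpecialFibreTowerPiDataInduces.lean` (abc-iut-L3-t2's landed `TemperedSpecialFibreTowerPiData.lean` is NOT
edited).

WHY A SUCCESSOR DATUM.  The record `SpecialFibreTower.PiData` ties the cusps `x` of `X_K` (`X.Pt`, `X.IsCusp`, `I_x =
X.inertia x`) to the special fibre ONLY through the level-`i` VERTEX `vtxOfCusp i x` met by the level cusp and the law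
(P3) `inertia_le_verticial` read through the LEVEL quotients `T.adm i`; it records no EDGE of `𝔾^c` for `x`, and no group
homomorphism `π₁^temp(𝒢^c_i) → π₁^temp(𝒢^c)` over `S.admissible` — so the BASE statements "`J_x := S.admissible(I_x ∩ Δ)`
lies in a verticial subgroup at the vertex `(proj i)(vtxOfCusp i x)`" (G-w4d070-g11-1) and "`J_x` is an edge-like
subgroup of the open edge `e_x` of `ξ_x`" are NOT derivable from the record (census: abc-iut-L5-d5,
`TemperedCoveringsCor23viGraphIncidence.lean`, module docstring).  In print both are part of the MEANING of "the cusp `ξ`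
of the stable model corresponding to `x`": the marked point `x` specialises to a smooth point `ξ` of a unique component,
`ξ` IS an open edge of the dual semi-graph, and the image of `I_x` in `π₁^temp(𝒢^c)` is the edge group `π̂₁(𝒢^c_{e_x})`.

THIS FILE: the Prop-valued ORIGIN DATUM **`P.CuspOpenEdgeDict`** — for every cusp `x` a branch `b_x` of `𝔾^c` abutting to
the record's vertex of `ξ_x`, every OTHER branch of its edge `e_x` abutting to no vertex (so `e_x` is open), and
`J_x ∈ edgeLikeSubgroups S.chart e_x` — stated so that consumers display `(hdict : P.CuspOpenEdgeDict)`; plus bookkeeping: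
the level-free form (`cuspOpenEdgeDict_iff`, `CuspOpenEdgeDict.atLevel`), openness (`CuspOpenEdgeDict.not_isClosedEdge`),
and the vertex-level consequence G-w4d070-g11-1 (`CuspOpenEdgeDict.inertia_le_verticial_base`, by [SemiAnbd] Thm. 3.7
(iii) "edge-like ⊆ verticial of the abutting vertex", abc-iut-L3-t11's `exists_mem_verticialSubgroups_ge_of_le_edgeLike`).
HONEST LIMITS: an origin datum is a HYPOTHESIS about THE special fibre of a curve, asserted for no curve; it does not
assert that `x ↦ e_x` is a bijection onto the open edges (not needed by any consumer), nor that `J_x ≠ 1`.  No instance,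
no notation, no `Prop` FACT (a predicate on the record); nothing here bears on [IUTchIII] Cor. 3.12 or asserts that abc
is proved or refuted.
-/

noncomputable section

namespace Literature.AnabelianGeometry.SemiGraphs

namespace SpecialFibreTower

namespace PiData

open ProfiniteSemiGraph

variable {p : ℕ} [Fact p.Prime] {X : TemperedCurve p} {d : X.GroupLevelData}
  {S : SpecialFibreData (X.toTemperedArithmeticGroup d)} {T : SpecialFibreTower X.DeltaTemp}

/-- **ORIGIN DATUM (P3′): the cusp ↦ OPEN-EDGE dictionary of THE special fibre** ([SemiAnbd] Ex. 3.10 p. 44: the cusps of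
`X_K` are the open edges of `G^c`; §6 p. 71: `I_x`; [IUTchI] Cor. 2.3 (vi) p. 48: "`ξ` the cusp of the stable model
corresponding to `x`"): for every cusp `x` there is a branch `b` of `𝔾^c` abutting to the vertex met by `ξ_x` (the
record's (P3) vertex, read at level `0`; level-free by `proj_vtxOfCusp`), every other branch of the edge of `b` abuts to
no vertex, and the cuspidal subgroup `J_x = S.admissible(I_x ∩ Δ)` IS an edge-like subgroup of that edge.  A HYPOTHESIS on
the genuine datum (policy D). [cite: MochizukiSemiAnbd2006, Ex 3.10 p.44] -/
def CuspOpenEdgeDict (P : PiData X d S T) : Prop :=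
  ∀ x : {x : X.Pt // X.IsCusp x}, ∃ b : S.Gc.graph.Branch,
    S.Gc.graph.abuts b = some ((P.proj 0).vertexMap (P.vtxOfCusp 0 x)) ∧
    (∀ b' : S.Gc.graph.Branch, S.Gc.graph.edgeOf b' = S.Gc.graph.edgeOf b → b' ≠ b →
      S.Gc.graph.abuts b' = none) ∧
    ((X.inertia x.1).subgroupOf (X.toTemperedArithmeticGroup d).delta).map S.admissible.toMonoidHom ∈
      edgeLikeSubgroups S.chart (S.Gc.graph.edgeOf b)

/-- Unfolding. [cite: MochizukiSemiAnbd2006, Ex 3.10 p.44] -/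
theorem cuspOpenEdgeDict_iff (P : PiData X d S T) :
    P.CuspOpenEdgeDict ↔ ∀ x : {x : X.Pt // X.IsCusp x}, ∃ b : S.Gc.graph.Branch,
      S.Gc.graph.abuts b = some ((P.proj 0).vertexMap (P.vtxOfCusp 0 x)) ∧
      (∀ b' : S.Gc.graph.Branch, S.Gc.graph.edgeOf b' = S.Gc.graph.edgeOf b → b' ≠ b →
        S.Gc.graph.abuts b' = none) ∧
      ((X.inertia x.1).subgroupOf (X.toTemperedArithmeticGroup d).delta).map S.admissible.toMonoidHom ∈
        edgeLikeSubgroups S.chart (S.Gc.graph.edgeOf b) :=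
  Iff.rfl

/-- **The datum at ANY level `i`** (the record's vertex of `ξ_x` does not depend on the level, `proj_vtxOfCusp`) — verbatim
the binder `hdictO` of the [IUTchI] Cor. 2.3 (vi) consumer with `vtx x := (P.proj i).vertexMap (P.vtxOfCusp i x)`.
[cite: Mochizuki2012, Cor 2.3(vi) p.48] -/
theorem CuspOpenEdgeDict.atLevel {P : PiData X d S T} (h : P.CuspOpenEdgeDict) (i : ℕ) :
    ∀ x : {x : X.Pt // X.IsCusp x}, ∃ b : S.Gc.graph.Branch,
      S.Gc.graph.abuts b = some ((P.proj i).vertexMap (P.vtxOfCusp i x)) ∧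
      (∀ b' : S.Gc.graph.Branch, S.Gc.graph.edgeOf b' = S.Gc.graph.edgeOf b → b' ≠ b →
        S.Gc.graph.abuts b' = none) ∧
      ((X.inertia x.1).subgroupOf (X.toTemperedArithmeticGroup d).delta).map S.admissible.toMonoidHom ∈
        edgeLikeSubgroups S.chart (S.Gc.graph.edgeOf b) := by
  intro x
  rw [P.proj_vtxOfCusp i 0 x]
  exact h x

/-- **The cusp edge is OPEN**: an edge one of whose branches abuts to no vertex is not closed (a closed edge has verticial
cardinality `2`, i.e. both of its two branches abut). [cite: MochizukiSemiAnbd2006, §1 p.12] -/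
theorem CuspOpenEdgeDict.not_isClosedEdge {b : S.Gc.graph.Branch}
    (hother : ∀ b' : S.Gc.graph.Branch, S.Gc.graph.edgeOf b' = S.Gc.graph.edgeOf b → b' ≠ b →
      S.Gc.graph.abuts b' = none) : ¬ S.Gc.graph.IsClosedEdge (S.Gc.graph.edgeOf b) := by
  intro hcl
  obtain ⟨b₁, b₂, h12, hb₁, hb₂, hall⟩ := S.Gc.graph.two_branches (S.Gc.graph.edgeOf b)
  -- the branch of `e_x` other than `b` abuts to no vertex
  obtain ⟨b₀, hb₀e, hb₀⟩ : ∃ b₀ : S.Gc.graph.Branch, S.Gc.graph.edgeOf b₀ = S.Gc.graph.edgeOf b ∧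
      S.Gc.graph.abuts b₀ = none := by
    rcases hall b rfl with rfl | rfl
    · exact ⟨b₂, hb₂, hother b₂ hb₂ (Ne.symm h12)⟩
    · exact ⟨b₁, hb₁, hother b₁ hb₁ h12⟩
  unfold SemiGraph.IsClosedEdge SemiGraph.vertCard at hcl
  obtain ⟨x, y, hxy, -⟩ := Nat.card_eq_two_iff.mp hcl
  have key : ∀ z : S.Gc.graph.verticialPortion (S.Gc.graph.edgeOf b), (z : S.Gc.graph.Branch) ≠ b₀ := by
    intro z hz
    have h2 := z.2.2
    rw [hz, hb₀] at h2
    exact Bool.false_ne_true h2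
  rcases hall x.1 x.2.1 with hx | hx <;> rcases hall y.1 y.2.1 with hy | hy
  · exact hxy (Subtype.ext (hx.trans hy.symm))
  · rcases hall b₀ hb₀e with h0 | h0
    · exact key x (hx.trans h0.symm)
    · exact key y (hy.trans h0.symm)
  · rcases hall b₀ hb₀e with h0 | h0
    · exact key y (hy.trans h0.symm)
    · exact key x (hx.trans h0.symm)
  · exact hxy (Subtype.ext (hx.trans hy.symm))

/-- **The datum yields the BASE CUSP INCIDENCE (GAP G-w4d070-g11-1)** — the `𝔾^c`-level form of the record's law (P3)
`inertia_le_verticial`: `J_x` lies in a verticial subgroup of `π₁^temp(G^c)` at the vertex of `ξ_x`, by [SemiAnbd] Thm.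
3.7 (iii) "an edge-like subgroup lies in a verticial subgroup of each abutting vertex" (abc-iut-L3-t11's
`exists_mem_verticialSubgroups_ge_of_le_edgeLike`; Thm. 3.7 (i) existence `verticialSubgroups_nonempty`).
[cite: MochizukiSemiAnbd2006, Thm 3.7(iii) p.41] -/
theorem CuspOpenEdgeDict.inertia_le_verticial_base {P : PiData X d S T} (h : P.CuspOpenEdgeDict) (i : ℕ)
    (x : {x : X.Pt // X.IsCusp x}) :
    ∃ K ∈ verticialSubgroups S.chart ((P.proj i).vertexMap (P.vtxOfCusp i x)),
      ((X.inertia x.1).subgroupOf (X.toTemperedArithmeticGroup d).delta).map S.admissible.toMonoidHom ≤ K := by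
  obtain ⟨b, hb, -, hJ⟩ := h.atLevel i x
  exact exists_mem_verticialSubgroups_ge_of_le_edgeLike S.chart hb hJ le_rfl (S.verticialSubgroups_nonempty _)

end PiData

end SpecialFibreTower

end Literature.AnabelianGeometry.SemiGraphs

end
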